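import Literature.NumberTheory.EllipticCurves.HeathBrown1994.CongruentTwoSelmerMonskyFamilies
import HarnessLib

set_option linter.dupNamespace false -- `Summit.BirchSwinnertonDyer.BirchSwinnertonDyer.Theorems.…` (summit = sub)
set_option autoImplicit false

/-!
# Route `BiquadraticEisensteinDescent` — DEFINITIONS (D-0017 `Theorems/<RouteSlug><Topic>Defs.lean`, reviewed):
# the SYMBOLIC MONSKY ENGINE and the data of the SIGN-TABLE GAME of crux idea `sign-table-character-dichotomy`
# (crux `HeegnerTwistCouplingInSupply`, stmt-BirchSwinnertonDyer-21381)

Cell `pub/bsd-wall`, width-prover seat `bsd-wall-cm-bed-w3` g18 (explicit-unit), route `BiquadraticEisensteinDescent`, crux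
stmt-BirchSwinnertonDyer-21381 `HeegnerTwistCouplingInSupply`; serves the crux idea card
`Cruxes/HeegnerTwistCouplingInSupply/Ideas/sign-table-character-dichotomy.md` (cruxidea seat 2 g24, 2026-08-29): its
«first PROVABLE rung» — the finite COMPLETION LEMMA of the sign-table game at `k = 0, 1` — asks for a SYMBOLIC Monsky
matrix ("to be typed over a symbolic Monsky matrix and discharged by `decide`, then transported to `monskyMatrixOdd` by
'the matrix depends only on the symbol data'"). This file holds the DEFINITIONS (computable, kernel-decidable); the
companion proof files `…HeegnerTwistCouplingInSupplySymbolicMonskySound.lean` / `…Transport.lean` prove them sound and the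
file `…HeegnerTwistCouplingInSupplySignTableCompletion.lean` decides the completion lemmas over the covers of
`BiquadraticEisensteinDescentSignTableCoversDefs.lean`.

* §1 Generic `𝔽₂` tools on bitmask rows: `xorFold`, `bz : Bool → ZMod 2`, `ofBits`, the row product `xorSelFrom`, the
  row-by-row product check `mulRowsCheck R N` (`R · N = 1`), an UNVERIFIED Gauss–Jordan oracle `invOracle` and the
  verified-by-product invertibility check `detCheckRows R := mulRowsCheck R (invOracle |R| R)` — the oracle's output is only
  ever consumed through the verified product check, so no property of the oracle is ever needed (or proved);
  `matOfRows m R` is the `𝔽₂`-matrix with bitmask rows `R`.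
* §2 SYMBOL DATA `SymbData k` of `k` distinct odd primes `P₀ … P_{k−1}` = residue classes mod `8` (`Fin 4 ↦ 1,3,5,7`,
  `clsVal`) and the strictly upper symbols `up i j = [(P_j/P_i) = −1]` (`i < j`); the completed symbol `neg` (quadratic
  reciprocity below the diagonal), the Boolean entries `entryOdd` / `entryEven` of Monsky's matrices
  `(A + D₂, D₂; D₂, A + D₋₂)` / `(Aᵀ + D₂, D₋₁; D₂, A + D₂)` [HeathBrown1994, appendix (Monsky), typescript p. 39 L27–L32,
  p. 41 L20–L36; tree `HeathBrown1994.monskyMatrixOdd/Even`], the symbolic matrices `monskyOddS` / `monskyEvenS` over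
  `ZMod 2` on `Fin k ⊕ Fin k`, their bitmask rows and the checks `detCheckOdd` / `detCheckEven`; the predicate
  `Matches P d` ("the primes `P : Fin k → ℕ` realise the data `d`").
* §3 The SIGN-TABLE GAME data (card §Lever, DATA-seat2-g24 §Model): a `Recipe` of the prover (cells `(class, [(q_i/r) = −1])`
  of the auxiliary primes `q₁ … q_t`, the table's signs `[(q_i/p) = −1]` it assumes, the mutual symbols `[(q_j/q_i) = −1]` it
  chooses), the symbol data `dataK0` / `dataK1` of `(p, q…)` / `(p, r, q…)` it determines on the bases `E_p`, `E_{2p}` /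
  `E_{pr}`, `E_{2pr}`, the HEEGNER side conditions `heegner` (`t ≥ 1`, `q₁⋯q_t ≡ 7 (8)`, `(−q₁⋯q_t/p) = (−q₁⋯q_t/r) = +1`),
  the win predicates `winsP` / `wins2P` / `winsPR` / `wins2PR` (Heegner ∧ `det = 1`), the realisation predicates
  `RealisesK0` / `RealisesK1` (actual primes with these classes and symbols), sign tables as bitmasks (`cellIdx`,
  `Recipe.applies`) and the CHARACTER tables `isCharK0` / `isCharK1` (the `4` / `8` characters of `(ℤ/8)ˣ` / `(ℤ/8)ˣ × {±1}`);
  `sgn : Bool → ℤ` (`true ↦ −1`).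

DEFINITIONS ONLY (structures, computable functions, two `Prop`-valued structures with parameters); no theorem, no named
fact, no `sorry`, no instance, no notation. Nothing here asserts anything about Selmer groups, `L`-values, the crux or BSD.
References: [HeathBrown1994] D. R. Heath-Brown, Invent. Math. 118 (1994) 331–370, appendix by P. Monsky (typescript pp. 38–42).
-/

namespace Summit.BirchSwinnertonDyer.BirchSwinnertonDyer.Theorems.SymbolicMonsky

open Matrix Literature.NumberTheory.EllipticCurves Literature.NumberTheory.EllipticCurves.HeathBrown1994
  Literature.NumberTheory.EllipticCurves.HeathBrown1994.Families

/-! ## §1 Generic Boolean / bitmask tools -/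

/-- XOR-fold of a Boolean function over a list. -/
def xorFold {α : Type*} (L : List α) (f : α → Bool) : Bool :=
  L.foldr (fun a acc => xor (f a) acc) false

/-- `Bool ↦ ZMod 2`. -/
def bz (b : Bool) : ZMod 2 := if b then 1 else 0

/-- The natural number with the given list of bits (least significant first). -/
def ofBits : List Bool → ℕ
  | [] => 0
  | b :: bs => Nat.bit b (ofBits bs)

/-- XOR of the rows `N[l]` over the set bits `l ≥ l₀` of `m` (row `m · N` over `𝔽₂`, positions shifted by `l₀`). -/
def xorSelFrom (m : ℕ) : ℕ → List ℕ → ℕ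
  | _, [] => 0
  | l, r :: rs => (if m.testBit l then r else 0) ^^^ xorSelFrom m (l + 1) rs

/-- Row-by-row check that `R · N = 1` over `𝔽₂` (rows as bitmasks): row `i` of the product must be `2 ^ i`. -/
def mulRowsCheckFrom (N : List ℕ) : ℕ → List ℕ → Bool
  | _, [] => true
  | i, r :: rs => (xorSelFrom r 0 N == 2 ^ i) && mulRowsCheckFrom N (i + 1) rs

/-- `R · N = 1` over `𝔽₂` (bitmask rows), with the side condition `|N| = |R|`. -/
def mulRowsCheck (R N : List ℕ) : Bool :=
  (N.length == R.length) && mulRowsCheckFrom N 0 R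

/-- One elimination step of the (UNVERIFIED) Gauss–Jordan oracle: state = (pending rows, finished pivots), each row paired
with its bookkeeping vector; column `c`. -/
def gjStep (c : ℕ) (st : List (ℕ × ℕ) × List (ℕ × ℕ)) : List (ℕ × ℕ) × List (ℕ × ℕ) :=
  let (pend, done) := st
  match pend.find? (fun rv => rv.1.testBit c) with
  | none => (pend, done ++ [(0, 0)])
  | some pv =>
    let elim : ℕ × ℕ → ℕ × ℕ := fun rv => if rv.1.testBit c then (rv.1 ^^^ pv.1, rv.2 ^^^ pv.2) else rv
    let pend' := (pend.erase pv).map elim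
    let done' := done.map elim
    (pend', done' ++ [pv])

/-- The (UNVERIFIED) Gauss–Jordan oracle: a candidate inverse of the `m × m` matrix with bitmask rows `R` (rows of the
candidate, as bitmasks). Its output is only ever used through the verified product check `mulRowsCheck`. -/
def invOracle (m : ℕ) (R : List ℕ) : List ℕ :=
  let init : List (ℕ × ℕ) := R.zipIdx.map fun ri => (ri.1, 2 ^ ri.2)
  let fin := (List.range m).foldl (fun st c => gjStep c st) (init, [])
  fin.2.map Prod.snd

/-- Verified-by-product invertibility check of a square `𝔽₂` matrix given by bitmask rows. -/
def detCheckRows (R : List ℕ) : Bool :=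
  mulRowsCheck R (invOracle R.length R)

/-! ## §2 Symbol data and the symbolic Monsky matrices -/

/-- The odd residue classes mod `8`, indexed `0, 1, 2, 3 ↦ 1, 3, 5, 7`. -/
def clsVal : Fin 4 → ℕ := ![1, 3, 5, 7]

/-- `[(2/P) = −1]` for `P` in the class: classes `3, 5 (mod 8)`. -/
def negTwo : Fin 4 → Bool := ![false, true, true, false]

/-- `[(−1/P) = −1]`: classes `3, 7 (mod 8)`. -/
def negNegOne : Fin 4 → Bool := ![false, true, false, true]

/-- `[(−2/P) = −1]`: classes `5, 7 (mod 8)`. -/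
def negNegTwo : Fin 4 → Bool := ![false, false, true, true]

/-- Symbol data of `k` distinct odd primes `P₀, …, P_{k−1}`: residue classes mod `8` and, for `i < j`, the bit
`[(P_j/P_i) = −1]` (values of `up i j` for `i ≥ j` are ignored). -/
structure SymbData (k : ℕ) where
  /-- residue class of `P_i` mod `8` -/
  cls : Fin k → Fin 4
  /-- for `i < j`: `[(P_j/P_i) = −1]` -/
  up : Fin k → Fin k → Bool

namespace SymbData

variable {k : ℕ} (d : SymbData k)

/-- The completed symbol `[(P_j/P_i) = −1]` for `i ≠ j` (quadratic reciprocity below the diagonal). -/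
def neg (i j : Fin k) : Bool :=
  if i < j then d.up i j else xor (d.up j i) (negNegOne (d.cls i) && negNegOne (d.cls j))

/-- Boolean entries of Monsky's `A`: off the diagonal `[(P_j/P_i) = −1]`, on the diagonal the row parity. -/
def aEntry (i j : Fin k) : Bool :=
  if i = j then xorFold ((List.finRange k).filter (fun l => l ≠ i)) (d.neg i) else d.neg i j

/-- Boolean entries of Monsky's odd matrix `(A + D₂, D₂; D₂, A + D₋₂)`. -/
def entryOdd : Fin k ⊕ Fin k → Fin k ⊕ Fin k → Bool
  | .inl i, .inl j => xor (d.aEntry i j) (decide (i = j) && negTwo (d.cls i))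
  | .inl i, .inr j => decide (i = j) && negTwo (d.cls i)
  | .inr i, .inl j => decide (i = j) && negTwo (d.cls i)
  | .inr i, .inr j => xor (d.aEntry i j) (decide (i = j) && negNegTwo (d.cls i))

/-- Boolean entries of Monsky's even matrix `(Aᵀ + D₂, D₋₁; D₂, A + D₂)`. -/
def entryEven : Fin k ⊕ Fin k → Fin k ⊕ Fin k → Bool
  | .inl i, .inl j => xor (d.aEntry j i) (decide (i = j) && negTwo (d.cls i))
  | .inl i, .inr j => decide (i = j) && negNegOne (d.cls i)
  | .inr i, .inl j => decide (i = j) && negTwo (d.cls i)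
  | .inr i, .inr j => xor (d.aEntry i j) (decide (i = j) && negTwo (d.cls i))

/-- The symbolic odd Monsky matrix over `𝔽₂`. -/
def monskyOddS : Matrix (Fin k ⊕ Fin k) (Fin k ⊕ Fin k) (ZMod 2) :=
  Matrix.of fun x y => bz (d.entryOdd x y)

/-- The symbolic even Monsky matrix over `𝔽₂`. -/
def monskyEvenS : Matrix (Fin k ⊕ Fin k) (Fin k ⊕ Fin k) (ZMod 2) :=
  Matrix.of fun x y => bz (d.entryEven x y)

/-- The index list `inl 0, …, inl (k−1), inr 0, …, inr (k−1)` (position of `inl i` is `i`, of `inr i` is `k + i`). -/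
def idxList (k : ℕ) : List (Fin k ⊕ Fin k) :=
  (List.finRange k).map Sum.inl ++ (List.finRange k).map Sum.inr

/-- Bitmask rows of the symbolic odd matrix. -/
def rowsOdd : List ℕ :=
  (idxList k).map fun x => ofBits ((idxList k).map fun y => d.entryOdd x y)

/-- Bitmask rows of the symbolic even matrix. -/
def rowsEven : List ℕ :=
  (idxList k).map fun x => ofBits ((idxList k).map fun y => d.entryEven x y)

/-- Verified invertibility check of the symbolic odd matrix. -/
def detCheckOdd : Bool := detCheckRows d.rowsOdd

/-- Verified invertibility check of the symbolic even matrix. -/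
def detCheckEven : Bool := detCheckRows d.rowsEven

end SymbData

/-- The primes `P : Fin k → ℕ` REALISE the symbol data `d`: distinct primes in the prescribed classes mod `8` with the
prescribed symbols `(P_j/P_i)`, `i < j`. -/
structure Matches {k : ℕ} (P : Fin k → ℕ) (d : SymbData k) : Prop where
  /-- the `P_i` are primes -/
  prime : ∀ i, (P i).Prime
  /-- and pairwise distinct -/
  injective : Function.Injective P
  /-- `P_i` lies in the class `d.cls i` mod `8` -/
  mod_eight : ∀ i, P i % 8 = clsVal (d.cls i)
  /-- the symbols `(P_j/P_i)`, `i < j`, are the data's -/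
  up_iff : ∀ i j, i < j → (jacobiSym (P j) (P i) = -1 ↔ d.up i j = true)

/-! ## §3 The sign-table game data (bases `E_p`, `E_{2p}`, `E_{pr}`, `E_{2pr}`) -/

/-- A recipe of the prover in the sign-table game: auxiliary primes `q₁ … q_t` with CELLS `(class of q_i mod 8,
[(q_i/r) = −1])` (the second component is unused for the one-parameter bases), the table's SIGNS `[(q_i/p) = −1]` the
recipe assumes, and the MUTUAL symbols `pat[i][j−i−1] = [(q_j/q_i) = −1]` (`i < j`) the prover chooses. -/
structure Recipe where
  /-- cells of `q₁ … q_t` -/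
  cells : List (Fin 4 × Bool)
  /-- assumed `[(q_i/p) = −1]` -/
  signs : List Bool
  /-- chosen `[(q_j/q_i) = −1]`, `i < j`, upper rows -/
  pat : List (List Bool)

namespace Recipe

variable (r : Recipe)

/-- Number of auxiliary primes. -/
def t : ℕ := r.cells.length

/-- Cell `(class mod 8, [(q_i/r) = −1])` of the `i`-th auxiliary prime (default out of range). -/
def cell (i : ℕ) : Fin 4 × Bool := r.cells.getD i (0, false)

/-- Assumed sign `[(q_i/p) = −1]` of the `i`-th auxiliary prime (default out of range). -/
def sign (i : ℕ) : Bool := r.signs.getD i false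

/-- Mutual symbol `[(q_j/q_i) = −1]` for auxiliary indices `i < j` (default `false` out of range). -/
def qsym (i j : ℕ) : Bool := (r.pat.getD i []).getD (j - i - 1) false

/-- Symbol data of `(p, q₁, …, q_t)` for the one-parameter bases `E_p`, `E_{2p}` (`p` in class `pc`). -/
def dataK0 (pc : Fin 4) : SymbData (r.t + 1) where
  cls i := if i.val = 0 then pc else (r.cell (i.val - 1)).1
  up i j := if i.val = 0 then r.sign (j.val - 1) else r.qsym (i.val - 1) (j.val - 1)

/-- Symbol data of `(p, r, q₁, …, q_t)` for the two-parameter bases `E_{pr}`, `E_{2pr}` (`p` in class `pc`, `r` in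
class `rc`, `rp = [(r/p) = −1]`). -/
def dataK1 (pc rc : Fin 4) (rp : Bool) : SymbData (r.t + 2) where
  cls i := if i.val = 0 then pc else if i.val = 1 then rc else (r.cell (i.val - 2)).1
  up i j :=
    if i.val = 0 then (if j.val = 1 then rp else r.sign (j.val - 2))
    else if i.val = 1 then (r.cell (j.val - 2)).2
    else r.qsym (i.val - 2) (j.val - 2)

/-- The primes `p` and `q : Fin t → ℕ` REALISE the recipe on a one-parameter base (`p` in class `pc`): classes, the table's
signs `(q_i/p)` and the chosen mutual symbols are as recorded. -/
structure RealisesK0 (pc : Fin 4) (p : ℕ) (q : Fin r.t → ℕ) : Prop where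
  /-- `p` is prime -/
  pprime : p.Prime
  /-- the `q_i` are prime -/
  qprime : ∀ i, (q i).Prime
  /-- `p` is in class `pc` mod `8` -/
  p_mod : p % 8 = clsVal pc
  /-- `q_i` is in the class of its cell -/
  q_mod : ∀ i, q i % 8 = clsVal (r.cell i).1
  /-- `q_i ≠ p` -/
  q_ne_p : ∀ i, q i ≠ p
  /-- the `q_i` are distinct -/
  qinj : Function.Injective q
  /-- the sign `(q_i/p)` is the assumed one -/
  sign_iff : ∀ i, jacobiSym (q i) p = -1 ↔ r.sign i = true
  /-- the mutual symbols `(q_j/q_i)`, `i < j`, are the chosen ones -/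
  qsym_iff : ∀ i j : Fin r.t, i < j → (jacobiSym (q j) (q i) = -1 ↔ r.qsym i j = true)

/-- The primes `p, r` and `q : Fin t → ℕ` REALISE the recipe on a two-parameter base (`p` in class `pc`, `r` in class `rc`,
`[(r/p) = −1] = rp`). -/
structure RealisesK1 (pc rc : Fin 4) (rp : Bool) (p r' : ℕ) (q : Fin r.t → ℕ) : Prop where
  /-- `p` is prime -/
  pprime : p.Prime
  /-- `r` is prime -/
  rprime : r'.Prime
  /-- the `q_i` are prime -/
  qprime : ∀ i, (q i).Prime
  /-- `p` is in class `pc` mod `8` -/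
  p_mod : p % 8 = clsVal pc
  /-- `r` is in class `rc` mod `8` -/
  r_mod : r' % 8 = clsVal rc
  /-- `q_i` is in the class of its cell -/
  q_mod : ∀ i, q i % 8 = clsVal (r.cell i).1
  /-- `p ≠ r` -/
  p_ne_r : p ≠ r'
  /-- `q_i ≠ p` -/
  q_ne_p : ∀ i, q i ≠ p
  /-- `q_i ≠ r` -/
  q_ne_r : ∀ i, q i ≠ r'
  /-- the `q_i` are distinct -/
  qinj : Function.Injective q
  /-- `(r/p)` is the base's -/
  rp_iff : jacobiSym r' p = -1 ↔ rp = true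
  /-- the sign `(q_i/p)` is the assumed one -/
  sign_iff : ∀ i, jacobiSym (q i) p = -1 ↔ r.sign i = true
  /-- `(q_i/r)` is the cell's -/
  eps_iff : ∀ i, jacobiSym (q i) r' = -1 ↔ (r.cell i).2 = true
  /-- the mutual symbols `(q_j/q_i)`, `i < j`, are the chosen ones -/
  qsym_iff : ∀ i j : Fin r.t, i < j → (jacobiSym (q j) (q i) = -1 ↔ r.qsym i j = true)

/-- The HEEGNER side conditions of a recipe (for `K′ = ℚ(√−q₁⋯q_t)` and level `32 n₀²` / `16 n₀²`): `t ≥ 1`, shape,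
`q₁⋯q_t ≡ 7 (mod 8)` (so `2` splits), `(−q₁⋯q_t / p) = +1` (parity of the signs against `[(−1/p) = −1]`), and — for the
two-parameter bases — `(−q₁⋯q_t / r) = +1`. -/
def heegner (pc : Fin 4) (rc : Option (Fin 4)) : Bool :=
  decide (0 < r.t) && (r.signs.length == r.t) &&
    ((r.cells.map fun c => clsVal c.1).prod % 8 == 7) &&
    (xorFold r.signs id == negNegOne pc) &&
    (match rc with
      | none => true
      | some rc => xorFold r.cells (fun c => c.2) == negNegOne rc)

/-- A recipe WINS on base `E_p` (`p` in class `pc`): Heegner conditions and `det M_odd(p, q) = 1`. -/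
def winsP (pc : Fin 4) : Bool := r.heegner pc none && (r.dataK0 pc).detCheckOdd

/-- A recipe WINS on base `E_{2p}`. -/
def wins2P (pc : Fin 4) : Bool := r.heegner pc none && (r.dataK0 pc).detCheckEven

/-- A recipe WINS on base `E_{pr}`. -/
def winsPR (pc rc : Fin 4) (rp : Bool) : Bool := r.heegner pc (some rc) && (r.dataK1 pc rc rp).detCheckOdd

/-- A recipe WINS on base `E_{2pr}`. -/
def wins2PR (pc rc : Fin 4) (rp : Bool) : Bool := r.heegner pc (some rc) && (r.dataK1 pc rc rp).detCheckEven

end Recipe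

/-- Index of a cell `(a, e)` in a sign table encoded as a bitmask: `2a + e`. (One-parameter bases use `e = false`.) -/
def cellIdx (c : Fin 4 × Bool) : ℕ := 2 * c.1.val + (if c.2 then 1 else 0)

/-- The recipe APPLIES to the sign table `σ` (bitmask: bit `cellIdx c` = `[(q/p) = −1]` for `q` in cell `c`): the signs it
assumes are the table's. -/
def Recipe.applies (σ : ℕ) (r : Recipe) : Bool :=
  (r.cells.zip r.signs).all fun cs => σ.testBit (cellIdx cs.1) == cs.2

/-- The four additive characters of `(ℤ/8)ˣ`: `1`, `χ₋₄`, `χ₈`, `χ₋₈` (as `[ψ = −1]`). -/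
def charsMod8 : List (Fin 4 → Bool) := [fun _ => false, negNegOne, negTwo, negNegTwo]

/-- All cells of the one-parameter game (classes mod 8). -/
def cellsK0 : List (Fin 4 × Bool) := (List.finRange 4).map fun a => (a, false)

/-- All cells of the two-parameter game (class mod 8, `[(q/r) = −1]`). -/
def cellsK1 : List (Fin 4 × Bool) := cellsK0 ++ (List.finRange 4).map fun a => (a, true)

/-- The table `σ` (one-parameter game) IS A CHARACTER: `σ(a) = ψ(a)` for one of the four characters of `(ℤ/8)ˣ`. -/
def isCharK0 (σ : ℕ) : Bool :=
  charsMod8.any fun ψ => cellsK0.all fun c => σ.testBit (cellIdx c) == ψ c.1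

/-- The table `σ` (two-parameter game) IS A CHARACTER of the cell group `(ℤ/8)ˣ × {±1}`: `σ(a, e) = ψ(a) · e^s`. -/
def isCharK1 (σ : ℕ) : Bool :=
  charsMod8.any fun ψ => [false, true].any fun s => cellsK1.all fun c => σ.testBit (cellIdx c) == xor (ψ c.1) (s && c.2)


/-- The `𝔽₂` matrix with the given bitmask rows (`m` columns). -/
def matOfRows (m : ℕ) (R : List ℕ) : Matrix (Fin m) (Fin m) (ZMod 2) :=
  Matrix.of fun i j => bz ((R.getD i 0).testBit j)

/-- `±1` from a bit: `true ↦ −1`. -/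
def sgn (b : Bool) : ℤ := if b then -1 else 1

end Summit.BirchSwinnertonDyer.BirchSwinnertonDyer.Theorems.SymbolicMonsky
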